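import Summits.KontsevichZagierPeriods.KontsevichZagierPeriods.Theorems.HurwitzMicroSectorsNormalFormPrincipleSlabASubPtK24
import Summits.KontsevichZagierPeriods.KontsevichZagierPeriods.Theorems.AbelContractionRealHyperellipticSectorBudgetKit

/-!
# Route AbelContraction — `RealHyperellipticSector` (crux stmt-KontsevichZagierPeriods-12475):
# the dimension-certified port, layer 1 — Newton–Leibniz over the point with ALGEBRAIC ends

Helper file of the line `Lines/birth.lean` (stub `stub_bakerAlg`, `--supports` the crux): the port
of `Theorems/HurwitzMicroSectorsNormalFormPrincipleSlabASubPtK24.lean` (namespace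
`…NormalFormPrinciple.PiBox.SlabA`) INTO THE BUDGET `KZ.relationsLE 1`.

The move (`slabA_sub_pt_mem_relationsLE`, registered sub-goal): let `α ≤ β` be real algebraic
numbers, `N = [(α,β), f]` an interval representation whose integrand `x ↦ f(x₀)` is
`ℚ`-semialgebraic on the closed slab `{α ≤ x₀ ≤ β}`, and `F` an abstract primitive of `f` on
`(α,β)` — `ℚ`-semialgebraic (read on the first coordinate) on the closed slab, continuous on
`[α,β]`. Then `[N] − [pt, F(β) − F(α)] ∈ relationsLE 1` for every point representation
`[pt, F(β) − F(α)]` over `ℝ⁰`: ONE Newton–Leibniz move `1 → 0` (rule 3) from the closed slab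
`R = [[α,β], f]` to the point, then rule 1a in dimension `1` across the two null endpoints and
congruence with `N` — each step with the certificate that its representations have dimension
`≤ 1` (budget kit `…RealHyperellipticSectorBudgetKit.lean`).

The dimension-free lemmas of the original (`isSemialgebraic_setOf_apply_mem_Icc`,
`isSemialgebraic_setOf_apply_mem_Ioo`) are reused by importing it.

Sources: M. Kontsevich, D. Zagier, *Periods* (2001), §1.2 rules (1), (3) [KontsevichZagier2001].
No definitions are introduced.
-/

noncomputable section

open MeasureTheory Set
open Literature.NumberTheory.Transcendental Literature.NumberTheory.Transcendental.KZ
open Literature.ModelTheory.ExponentialFields (IsSemialgebraic isSemialgebraic_univ)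

namespace Summit.KontsevichZagierPeriods.AbelContraction.RealHyperellipticSector.Port

namespace SlabA

open Summit.KontsevichZagierPeriods.HurwitzMicroSectors.NormalFormPrinciple.Negative
  (integrableOn_fin_one)
open Summit.KontsevichZagierPeriods.HurwitzMicroSectors.NormalFormPrinciple.PiBox.SlabA
  (isSemialgebraic_setOf_apply_mem_Icc isSemialgebraic_setOf_apply_mem_Ioo)

/-! ## The Newton–Leibniz move over the point inside the budget -/

/-- **Newton–Leibniz over the point, algebraic ends, abstract primitive** (rule 3 from dimension
`1` to dimension `0`, plus the null endpoints, rule 1a in dimension `1`) (inside the budget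
`relationsLE 1`; registered sub-goal of crux stmt-KontsevichZagierPeriods-12475, port of
`PiBox.SlabA.slabA_sub_pt_mem_relations`). Let `α ≤ β` be real algebraic, `N = [(α,β), f]` an
interval representation whose integrand `x ↦ f(x₀)` is `ℚ`-semialgebraic on the closed slab, and
`F` a primitive of `f` on `(α,β)` which, read on the first coordinate, is `ℚ`-semialgebraic on the
closed slab and continuous on `[α,β]`. Then `[N] − [pt, F(β) − F(α)] ∈ relationsLE 1` for every
point representation with that constant. [cite: KontsevichZagier2001, §1.2 rule (3)] -/
theorem slabA_sub_pt_mem_relationsLE : ∀ {α β : ℝ}, IsAlgebraic ℚ α → IsAlgebraic ℚ β → α ≤ β →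
    ∀ (f F : ℝ → ℝ),
    IsSemialgebraicFunOn ℚ {x : Fin 1 → ℝ | x 0 ∈ Set.Icc α β} (fun x => F (x 0)) →
    ContinuousOn F (Set.Icc α β) → (∀ t ∈ Set.Ioo α β, HasDerivAt F (f t) t) →
    IsSemialgebraicFunOn ℚ {x : Fin 1 → ℝ | x 0 ∈ Set.Icc α β} (fun x => f (x 0)) →
    ∀ (N : KZ.IntegralRep 1), N.domain = {x | x 0 ∈ Set.Ioo α β} →
    Set.EqOn N.integrand (fun x => f (x 0)) N.domain →
    ∀ (Z : KZ.IntegralRep 0), Z.domain = Set.univ → (Z.integrand = fun _ => F β - F α) →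
    KZ.of N - KZ.of Z ∈ KZ.relationsLE 1 := by
  intro α β hα hβ hαβ f F hF hFc hderiv hf N hNd hNi Z hZd hZi
  set C : Set (Fin 1 → ℝ) := {x | x 0 ∈ Set.Icc α β} with hC
  have hCsa : IsSemialgebraic ℚ C := isSemialgebraic_setOf_apply_mem_Icc hα hβ
  have hIoo : IsSemialgebraic ℚ {x : Fin 1 → ℝ | x 0 ∈ Set.Ioo α β} :=
    isSemialgebraic_setOf_apply_mem_Ioo hα hβ
  -- the integrand `f` on the closed slab is integrable (it is `N.integrand` a.e.)
  have hfi : IntegrableOn (fun x : Fin 1 → ℝ => f (x 0)) C := by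
    have h1 : IntegrableOn (fun x : Fin 1 → ℝ => f (x 0)) N.domain :=
      N.integrableOn.congr_fun hNi (IsSemialgebraic.measurableSet_holds N.isSemialgebraic_domain)
    rw [hNd, integrableOn_fin_one] at h1
    rw [hC, integrableOn_fin_one]
    exact h1.congr_set_ae (Ioo_ae_eq_Icc (a := α) (b := β)).symm
  -- the closed-slab representation `R = [[α,β], f]`
  obtain ⟨R, hRd, hRi⟩ : ∃ R : IntegralRep 1, R.domain = C ∧ R.integrand = fun x => f (x 0) :=
    ⟨⟨C, fun x => f (x 0), hCsa, hf, hfi⟩, rfl, rfl⟩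
  have hs0 : ∀ (x : Fin 0 → ℝ) (t : ℝ), (Fin.snoc x t : Fin 1 → ℝ) 0 = t := fun _ _ => rfl
  -- (i) ONE Newton–Leibniz move `1 → 0` over `ℝ⁰`: `[R] − [Z] ∈ relationsLE 1`, primitive `F (z 0)`
  have hNL : of R - of Z ∈ relationsLE 1 := by
    refine Budget.newtonLeibniz_mem_relationsLE le_rfl (fun _ => α) (fun _ => β)
      (fun z => F (z 0)) ?_ ?_ ?_ (fun _ _ => hαβ) ?_ ?_ ?_ ?_
    · rw [hRd]
      exact hF
    · rw [hZd]
      exact isSemialgebraicFunOn_const_of_isAlgebraic isSemialgebraic_univ hα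
    · rw [hZd]
      exact isSemialgebraicFunOn_const_of_isAlgebraic isSemialgebraic_univ hβ
    · rw [hRd, hZd, hC]
      ext z
      simp only [Set.mem_setOf_eq, Set.mem_Icc, Set.mem_univ, true_and]
      rfl
    · -- continuity of `t ↦ F t` on the closed fibre
      intro x _
      simpa only [hs0] using hFc
    · -- derivative on the open fibre
      intro x _ t ht
      rw [hRi]
      simpa only [hs0] using hderiv t ht
    · intro x _
      simp only [hZi, hs0]
  -- (ii) closed slab versus the open slab `N.domain` (null endpoints), and congruence with `N`
  have hEsub : {x : Fin 1 → ℝ | x 0 ∈ Set.Ioo α β} ⊆ R.domain := by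
    rw [hRd, hC]
    exact fun x hx => Set.Ioo_subset_Icc_self hx
  have hnull : volume (R.domain \ {x : Fin 1 → ℝ | x 0 ∈ Set.Ioo α β}) = 0 := by
    have hα0 : volume {w : Fin 1 → ℝ | w 0 = α} = 0 := by
      rw [volume_pi]
      exact Measure.pi_hyperplane _ _ _
    have hβ0 : volume {w : Fin 1 → ℝ | w 0 = β} = 0 := by
      rw [volume_pi]
      exact Measure.pi_hyperplane _ _ _
    refine measure_mono_null (fun x hx => ?_) (measure_union_null hα0 hβ0)
    rw [hRd, hC] at hx
    obtain ⟨⟨h1, h2⟩, h3⟩ := hx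
    simp only [Set.mem_setOf_eq, Set.mem_Ioo, not_and, not_lt] at h3
    simp only [Set.mem_union, Set.mem_setOf_eq]
    rcases h1.lt_or_eq with h1 | h1
    · exact Or.inr (le_antisymm h2 (h3 h1))
    · exact Or.inl h1.symm
  have h2 : of R - of (R.restrict _ hIoo hEsub) ∈ relationsLE 1 :=
    Budget.of_sub_of_restrict_mem_relationsLE le_rfl R hIoo hEsub hnull
  have h3 : of (R.restrict _ hIoo hEsub) - of N ∈ relationsLE 1 :=
    Budget.congr_mem_relationsLE le_rfl (by rw [hNd]; rfl) fun x hx => by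
      rw [IntegralRep.integrand_restrict, hRi, hNi (by rw [hNd]; exact hx)]
  have : of N - of Z = (of R - of Z) - (of R - of (R.restrict _ hIoo hEsub)) -
      (of (R.restrict _ hIoo hEsub) - of N) := by abel
  rw [this]
  exact (relationsLE 1).sub_mem ((relationsLE 1).sub_mem hNL h2) h3

end SlabA

end Summit.KontsevichZagierPeriods.AbelContraction.RealHyperellipticSector.Port

end
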